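import Literature.Analysis.ODE.RegularSingularEnergy
import Literature.Geometry.Lorentzian.TeukolskyBlowupPocketCoeff
import HarnessLib

/-!
# The `κ`-free horizon pocket for `|ξ| ≤ 1`, part 2: the energy bound
(namespace `Literature.Geometry.Lorentzian.Kerr`.)

Scalar radial Teukolsky equation on sub-extremal Kerr (Teixeira da Costa 2020, Def. 2.3; used by
the crux `KappaExplicitWaveDecay`, stub `stub_horizonSupBoxPoly`). Notation:
`d = r₊ − r₋`, `σ = ω − mω₊`, `ξ = (2Mr₊/d)σ = σ/(2κ)` (so that Teixeira da Costa's horizon exponent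
is `ξ_TdC = −iξ`, `Kerr.horizonExponent`), `x = (r − r₊)/d` the blown-up radius,
`W(x) = √(x(x+1)) R(r₊ + dx)`, and `Q` the coefficient of the Liouville normal form `W″ = Q W` of
the scalar radial Teukolsky ODE (Teukolsky–Press 1974 §II; in the tree the equivalence with the
radial ODE is the Summits-side `stub_olverNormalForm`, so here the normal form enters as a HYPOTHESIS):
`Q = ((Λ − 2amω)x(x+1) − k² − ¼)/(x(x+1))²`, `k = K(r₊ + dx)/d = ξ + ωx(2r₊ + dx)`
(`radialK_blowup_div`, part 1 `TeukolskyBlowupPocketCoeff.lean`).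

The point `x = 0` is a regular singular point with exponents `ν = ½ − iξ` and `ν̄`:
`x²Q = ν(ν − 1) + g`, `ν(ν − 1) = −ξ² − ¼`, and for `|ξ| ≤ 1`, `0 < x ≤ 1`,
`|g(x)| = |x²Q(x) + ξ² + ¼| ≤ C_g x` with the BOUNDED-FREQUENCY constant
`C_g = 4Λ + 6M|ω|(2 + 6M|ω|) + 15/4` (`blowup_pocket_coeff_abs_le`; no `κ` enters). The generic energy
bound at such a point (`Literature.Analysis.ODE.regularSingularEnergy_le_of_tendsto`, energy
`E = ‖W‖²/x + ‖xW′ − νW‖²/x²`, `E′ ≤ (1 + C_g)²E`) then gives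

* `blowup_pocketEnergy_le` — for the solution normalised at `𝓗⁺` (TdC Def. 2.3, `s = 0`:
  `R(r)(r − r₊)^{−ξ_TdC} = f(r)` smooth at `r₊`, `‖f(r₊)‖√(r₊² + a²) = 1`) and every `x ∈ (0, 1]`:
  `E(x) ≤ (r₊² + a²)⁻¹ exp((1 + C_g)²x)`, in particular `‖W(x)‖² ≤ x·e^{(1+C_g)²}/(r₊² + a²)` and
  `‖xW′(x) − νW(x)‖² ≤ x²·e^{(1+C_g)²}/(r₊² + a²)` (`blowup_pocket_normSq_le`).

The limit `E(x) → ‖f(r₊)‖² = (r₊² + a²)⁻¹` as `x → 0⁺` (`blowup_pocketEnergy_tendsto`) is read off the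
collar representation `W = √(x(x+1))·f(r₊ + dx)·(dx)^{ξ_TdC}`: there
`xW′ − νW = (dx)^{ξ_TdC}·(x²/(2√(x(x+1)))·f + x√(x(x+1))·d·f′)` (the `ξ`-terms cancel), so
`E(x) = (x + 1)‖f‖² + ‖(√x/(2√(x+1)))f + √(x(x+1))·d·f′‖²`, continuous at `x = 0`.
No named fact is used.

## References
* R. Teixeira da Costa, CMP 378 (2020) 705–781 = arXiv:1910.02854, §2.2.1 (`ξ`), Def. 2.3. [Costa2019]
* F. W. J. Olver, *Asymptotics and Special Functions* (1974), Ch. 5 §§4–5 (regular singular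
  points). [Olver1974]
* S. A. Teukolsky, W. H. Press, Astrophys. J. 193 (1974) 443–461, §II (the variable `x`).
-/

noncomputable section

namespace Literature.Geometry.Lorentzian

namespace Kerr

open Literature.Analysis.ODE
open Filter Set Complex
open scoped _root_.Topology ComplexConjugate

/-! ### The energy on the collar and its limit at `x = 0⁺` -/

/-- **The energy of the blown-up normalised solution tends to `(r₊² + a²)⁻¹` at the horizon.**
For `R` normalised at `𝓗⁺` (TdC Def. 2.3, `s = 0`, `0 < M`, `|a| < M`) and ANY derivative witness
`W′` of `W(y) = √(y(y+1))R(r₊ + dy)` on `y > 0`: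
`‖W y‖²/y + ‖yW′y − νWy‖²/y² → (r₊² + a²)⁻¹` as `y → 0⁺`, `ν = ½ + ξ_TdC`. On the collar
`W = √(y(y+1))·f(r₊ + dy)·(dy)^{ξ_TdC}` with `|(dy)^{ξ_TdC}| = 1`, so the energy equals
`(y + 1)‖f‖² + ‖(√y/(2√(y+1)))f + √(y(y+1))d·f′‖²` (`blowup_collar_xWsub_eq`), a function continuous at
`y = 0` with value `‖f(r₊)‖² = (r₊² + a²)⁻¹`. [cite: Costa2019, Definition 2.3] -/
theorem blowup_pocketEnergy_tendsto {M a ω m : ℝ} (hM : 0 < M) (ha : |a| < M) {R : ℝ → ℂ}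
    (hn : IsNormalisedHorizonSolution M a 0 ω m R) {W' : ℝ → ℂ}
    (hW : ∀ x : ℝ, 0 < x → HasDerivAt (fun y : ℝ ↦ ((Real.sqrt (y * (y + 1)) : ℝ) : ℂ) *
      R (rPlus M a + (rPlus M a - rMinus M a) * y)) (W' x) x) :
    Tendsto (fun y : ℝ ↦ ‖((Real.sqrt (y * (y + 1)) : ℝ) : ℂ) *
          R (rPlus M a + (rPlus M a - rMinus M a) * y)‖ ^ 2 / y +
        ‖(y : ℂ) * W' y - ((1 / 2 : ℂ) + horizonExponent M a ω m) *
          (((Real.sqrt (y * (y + 1)) : ℝ) : ℂ) *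
            R (rPlus M a + (rPlus M a - rMinus M a) * y))‖ ^ 2 / y ^ 2)
      (𝓝[>] 0) (𝓝 (rPlus M a ^ 2 + a ^ 2)⁻¹) := by
  obtain ⟨ε, hε, f, hf, hRf, hnorm⟩ := hn
  set d := rPlus M a - rMinus M a with hd_def
  set rp := rPlus M a with hrp_def
  set p : ℂ := horizonExponent M a ω m with hp_def
  have hd : 0 < d := sub_pos.2 (IsSubextremal.rMinus_lt_rPlus ha)
  have hpre : p.re = 0 := Costa2019.horizonExponent_re M a ω m
  have htop : ((⊤ : ℕ∞) : WithTop ℕ∞) ≠ 0 := by simp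
  have hrp0 : 0 < rp := rPlus_pos hM a
  have hA : 0 < rp ^ 2 + a ^ 2 := by positivity
  have hI0 : Ioo (rp - ε) (rp + ε) ∈ 𝓝 rp := Ioo_mem_nhds (by linarith) (by linarith)
  have hfc : ContinuousAt f rp := hf.continuousOn.continuousAt hI0
  have hf'c : ContinuousAt (deriv f) rp :=
    (hf.continuousOn_deriv_of_isOpen isOpen_Ioo (by simp)).continuousAt hI0
  set f' : ℝ → ℂ := deriv f with hf'_def
  -- the comparison function `G`, continuous at `0` with value `‖f r₊‖² = (r₊² + a²)⁻¹`
  set G : ℝ → ℝ := fun y ↦ (y + 1) * ‖f (rp + d * y)‖ ^ 2 +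
    ‖(((Real.sqrt y / (2 * Real.sqrt (y + 1))) : ℝ) : ℂ) * f (rp + d * y) +
      (((Real.sqrt (y * (y + 1)) * d) : ℝ) : ℂ) * f' (rp + d * y)‖ ^ 2 with hG_def
  have hθc : ContinuousAt (fun y : ℝ ↦ rp + d * y) 0 := by fun_prop
  have hfc0 : ContinuousAt (fun y : ℝ ↦ f (rp + d * y)) 0 :=
    ContinuousAt.comp_of_eq hfc hθc (by simp)
  have hf'c0 : ContinuousAt (fun y : ℝ ↦ f' (rp + d * y)) 0 :=
    ContinuousAt.comp_of_eq hf'c hθc (by simp)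
  have hq : ContinuousAt (fun y : ℝ ↦ Real.sqrt y / (2 * Real.sqrt (y + 1))) 0 :=
    (Real.continuous_sqrt.continuousAt).div (by fun_prop) (by norm_num)
  have hGc : ContinuousAt G 0 := by
    simp only [hG_def]
    have h1 : ContinuousAt (fun y : ℝ ↦ (((Real.sqrt y / (2 * Real.sqrt (y + 1))) : ℝ) : ℂ)) 0 :=
      Complex.continuous_ofReal.continuousAt.comp hq
    have h2 : ContinuousAt (fun y : ℝ ↦ (((Real.sqrt (y * (y + 1)) * d) : ℝ) : ℂ)) 0 := by
      fun_prop
    exact ((continuousAt_id.add continuousAt_const).mul (hfc0.norm.pow 2)).add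
      (((h1.mul hfc0).add (h2.mul hf'c0)).norm.pow 2)
  have hG0 : G 0 = (rp ^ 2 + a ^ 2)⁻¹ := by
    have h1 : ‖f rp‖ * Real.sqrt (rp ^ 2 + a ^ 2) = 1 := by
      rw [Real.rpow_zero, mul_one] at hnorm
      exact hnorm
    have h2 : ‖f rp‖ ^ 2 * (rp ^ 2 + a ^ 2) = 1 := by
      have := congrArg (· ^ 2) h1
      simpa only [mul_pow, Real.sq_sqrt hA.le, one_pow] using this
    simp only [hG_def, mul_zero, add_zero, Real.sqrt_zero, zero_div, zero_mul, zero_add,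
      Complex.ofReal_zero, one_mul, norm_zero]
    simpa using eq_inv_of_mul_eq_one_left h2
  have hlim : Tendsto G (𝓝[>] 0) (𝓝 (rp ^ 2 + a ^ 2)⁻¹) := by
    rw [← hG0]
    exact hGc.tendsto.mono_left nhdsWithin_le_nhds
  refine hlim.congr' ?_
  -- on `(0, ε/d)` the energy IS `G`
  have hεd : 0 < ε / d := div_pos hε hd
  filter_upwards [Ioo_mem_nhdsGT hεd] with y hy
  have hy0 : 0 < y := hy.1
  have hdy : d * y < ε := by
    have := (lt_div_iff₀ hd).1 hy.2
    linarith
  set r := rp + d * y with hr_def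
  have hr : rp < r := lt_add_of_pos_right _ (mul_pos hd hy0)
  have hrε : r < rp + ε := by simp only [hr_def]; linarith
  have hyI : Ioo (rp - ε) (rp + ε) ∈ 𝓝 r := Ioo_mem_nhds (by linarith) hrε
  have hfr : HasDerivAt f (f' r) r :=
    ((hf.differentiableOn htop r ⟨by linarith, hrε⟩).differentiableAt hyI).hasDerivAt
  -- the unimodular factor `T = (r − r₊)^{ξ_TdC} = (dy)^{ξ_TdC}`
  set T : ℂ := ((r - rp : ℝ) : ℂ) ^ p with hT_def
  have hsub : r - rp = d * y := by simp only [hr_def]; ring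
  have hTn : ‖T‖ = 1 := by
    rw [hT_def, Complex.norm_cpow_eq_rpow_re_of_pos (by rw [hsub]; positivity), hpre,
      Real.rpow_zero]
  have hD0 : ((r - rp : ℝ) : ℂ) ≠ 0 := by
    rw [hsub]; exact_mod_cast (mul_pos hd hy0).ne'
  have hRr : R r = f r * T := eq_mul_cpow_of_mul_cpow_sub_eq (sub_pos.2 hr) (hRf r ⟨hr, hrε⟩)
  -- `W = √(z(z+1))·f·T` near `y`, hence `W′ y` is the collar derivative
  have hev : (fun z : ℝ ↦ ((Real.sqrt (z * (z + 1)) : ℝ) : ℂ) * R (rp + d * z)) =ᶠ[𝓝 y]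
      fun z ↦ ((√(z * (z + 1)) : ℝ) : ℂ) *
        (f (rp + d * z) * (((rp + d * z - rp : ℝ) : ℂ)) ^ p) := by
    filter_upwards [Ioo_mem_nhds hy0 hy.2] with z hz
    have hz1 : rp < rp + d * z := lt_add_of_pos_right _ (mul_pos hd hz.1)
    have hz2 : rp + d * z < rp + ε := by
      have := (lt_div_iff₀ hd).1 hz.2
      linarith
    rw [eq_mul_cpow_of_mul_cpow_sub_eq (t := rp + d * z - rp) (by linarith)
      (hRf (rp + d * z) ⟨hz1, hz2⟩)]
  have hDer := (hasDerivAt_blowup_collar p hd hy0 hfr).congr_of_eventuallyEq hev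
  have hW'y := (hW y hy0).unique hDer
  -- `S = √(y(y+1))`
  set S := Real.sqrt (y * (y + 1)) with hS_def
  have hS0 : 0 < S := Real.sqrt_pos.2 (by positivity)
  have hS2 : S ^ 2 = y * (y + 1) := Real.sq_sqrt (by positivity)
  -- `yW′ − νW = T·(y²/(2S) f + ySd f′)`
  have hP : (y : ℂ) * W' y - ((1 / 2 : ℂ) + p) * ((S : ℂ) * R r) =
      T * (((y ^ 2 / (2 * S) : ℝ) : ℂ) * f r + ((y * S * d : ℝ) : ℂ) * f' r) := by
    rw [hW'y, hRr]
    have h := blowup_collar_xWsub_eq (S' := (2 * y + 1) / (2 * S)) (f₀ := f r) (f' := f' r) (T := T)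
      (p := p) (d := d) (y := y) hS0.ne' hS2 rfl
      (show ((r - rp : ℝ) : ℂ) = ((d * y : ℝ) : ℂ) by rw [hsub]) hy0.ne' hd.ne'
    simpa only [hr_def] using h
  -- `‖W‖²/y = (y + 1)‖f‖²`
  have h1 : ‖(S : ℂ) * R r‖ ^ 2 / y = (y + 1) * ‖f r‖ ^ 2 := by
    rw [hRr, norm_mul, norm_mul, hTn, mul_one, Complex.norm_of_nonneg hS0.le, mul_pow, hS2]
    field_simp
  -- `‖yW′ − νW‖²/y² = ‖(√y/(2√(y+1)))f + S d f′‖²`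
  have hq2 : y ^ 2 / (2 * S) = y * (Real.sqrt y / (2 * Real.sqrt (y + 1))) := by
    have hS' : S = Real.sqrt y * Real.sqrt (y + 1) := by
      rw [hS_def]; exact Real.sqrt_mul hy0.le _
    have hyy : Real.sqrt y * Real.sqrt y = y := Real.mul_self_sqrt hy0.le
    have h0 : 0 < Real.sqrt y := Real.sqrt_pos.2 hy0
    have h1' : 0 < Real.sqrt (y + 1) := Real.sqrt_pos.2 (by linarith)
    rw [hS']
    field_simp
    nlinarith [hyy]
  have h2 : ‖T * (((y ^ 2 / (2 * S) : ℝ) : ℂ) * f r + ((y * S * d : ℝ) : ℂ) * f' r)‖ ^ 2 / y ^ 2 =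
      ‖(((Real.sqrt y / (2 * Real.sqrt (y + 1))) : ℝ) : ℂ) * f r +
        (((S * d) : ℝ) : ℂ) * f' r‖ ^ 2 := by
    have e : ((y ^ 2 / (2 * S) : ℝ) : ℂ) * f r + ((y * S * d : ℝ) : ℂ) * f' r =
        (y : ℂ) * ((((Real.sqrt y / (2 * Real.sqrt (y + 1))) : ℝ) : ℂ) * f r +
          (((S * d) : ℝ) : ℂ) * f' r) := by
      rw [hq2]
      push_cast
      ring
    rw [norm_mul, hTn, one_mul, e, norm_mul, Complex.norm_real, Real.norm_eq_abs, abs_of_pos hy0,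
      mul_pow]
    field_simp
  rw [hP, h1, h2]

/-! ### The `κ`-free pocket bound -/

/-- **The `κ`-free horizon pocket (`|ξ| ≤ 1`).** Let `0 < M`, `|a| < M`, `(ω, m, Λ)` admissible,
`|ξ| ≤ 1` (`ξ = (2Mr₊/(r₊ − r₋))(ω − mω₊)`), `R` normalised at `𝓗⁺` (TdC Def. 2.3, `s = 0`), and let
`W′, W″` be derivative witnesses of `W(y) = √(y(y+1))R(r₊ + dy)` on `y > 0` with `W″ = QW` (the
shape produced by `stub_olverNormalForm`). Then for `x ∈ (0, 1]`:
`‖W x‖²/x + ‖xW′x − νWx‖²/x² ≤ (r₊² + a²)⁻¹ exp((1 + C_g)²x)`, `ν = ½ + ξ_TdC`,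
`C_g = 4Λ + 6M|ω|(2 + 6M|ω|) + 15/4` (`Literature.Analysis.ODE.regularSingularEnergy_le_of_tendsto`
with `blowup_pocket_coeff_abs_le` and `blowup_pocketEnergy_tendsto`). [cite: Olver1974, Ch. 5 §5] -/
theorem blowup_pocketEnergy_le {M a ω Λ : ℝ} {m : ℤ} (hM : 0 < M) (ha : |a| < M)
    (hadm : IsAdmissibleTriple a ω m Λ)
    (hξ : |2 * M * rPlus M a / (rPlus M a - rMinus M a) *
        (ω - m * horizonAngularVelocity M a)| ≤ 1)
    {R : ℝ → ℂ} (hn : IsNormalisedHorizonSolution M a 0 ω m R) {W' W'' : ℝ → ℂ}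
    (hW : ∀ x : ℝ, 0 < x →
      HasDerivAt (fun y : ℝ ↦ ((Real.sqrt (y * (y + 1)) : ℝ) : ℂ) *
          R (rPlus M a + (rPlus M a - rMinus M a) * y)) (W' x) x ∧
        HasDerivAt W' (W'' x) x ∧
        W'' x =
          ((((Λ - 2 * a * m * ω) * (x * (x + 1)) -
                  (radialK a ω m (rPlus M a + (rPlus M a - rMinus M a) * x) /
                      (rPlus M a - rMinus M a)) ^ 2 - 1 / 4) /
                (x * (x + 1)) ^ 2 : ℝ) : ℂ) *
            (((Real.sqrt (x * (x + 1)) : ℝ) : ℂ) *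
              R (rPlus M a + (rPlus M a - rMinus M a) * x)))
    {x : ℝ} (hx : x ∈ Ioc (0 : ℝ) 1) :
    ‖((Real.sqrt (x * (x + 1)) : ℝ) : ℂ) *
            R (rPlus M a + (rPlus M a - rMinus M a) * x)‖ ^ 2 / x +
        ‖(x : ℂ) * W' x - ((1 / 2 : ℂ) + horizonExponent M a ω m) *
            (((Real.sqrt (x * (x + 1)) : ℝ) : ℂ) *
              R (rPlus M a + (rPlus M a - rMinus M a) * x))‖ ^ 2 / x ^ 2 ≤
      (rPlus M a ^ 2 + a ^ 2)⁻¹ *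
        Real.exp ((1 + (4 * Λ + 6 * M * |ω| * (2 + 6 * M * |ω|) + 15 / 4)) ^ 2 * x) := by
  set d := rPlus M a - rMinus M a with hd_def
  set Q : ℝ → ℝ := fun x ↦ ((Λ - 2 * a * m * ω) * (x * (x + 1)) -
      (radialK a ω m (rPlus M a + d * x) / d) ^ 2 - 1 / 4) / (x * (x + 1)) ^ 2 with hQ_def
  set ξ := 2 * M * rPlus M a / d * (ω - m * horizonAngularVelocity M a) with hξ_def
  refine regularSingularEnergy_le_of_tendsto (q := fun x ↦ (Q x : ℂ)) (b := 1) (blowup_nu_re M a ω m)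
    (fun y hy ↦ ⟨(hW y hy.1).1, ?_⟩) (fun y hy ↦ ?_)
    (blowup_pocketEnergy_tendsto hM ha hn fun y hy ↦ (hW y hy).1) hx
  · obtain ⟨-, h2, h3⟩ := hW y hy.1
    rw [h3] at h2
    exact h2
  · rw [blowup_nu_mul_nu_sub_one]
    have h := blowup_pocket_coeff_abs_le hM ha hadm hξ hy.1 hy.2
    have e : (y : ℂ) ^ 2 * (Q y : ℂ) - ((-ξ ^ 2 - 1 / 4 : ℝ) : ℂ) =
        ((y ^ 2 * Q y + (ξ ^ 2 + 1 / 4) : ℝ) : ℂ) := by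
      push_cast
      ring
    rw [e, Complex.norm_real, Real.norm_eq_abs]
    exact h

/-- **Pointwise form of the pocket bound**: under the hypotheses of `blowup_pocketEnergy_le`, for
`x ∈ (0, 1]`: `‖W x‖² ≤ x·B` and `‖xW′x − νWx‖² ≤ x²·B` with
`B = exp((1 + C_g)²)/(r₊² + a²)`. [folklore] -/
theorem blowup_pocket_normSq_le {M a ω Λ : ℝ} {m : ℤ} (hM : 0 < M) (ha : |a| < M)
    (hadm : IsAdmissibleTriple a ω m Λ)
    (hξ : |2 * M * rPlus M a / (rPlus M a - rMinus M a) *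
        (ω - m * horizonAngularVelocity M a)| ≤ 1)
    {R : ℝ → ℂ} (hn : IsNormalisedHorizonSolution M a 0 ω m R) {W' W'' : ℝ → ℂ}
    (hW : ∀ x : ℝ, 0 < x →
      HasDerivAt (fun y : ℝ ↦ ((Real.sqrt (y * (y + 1)) : ℝ) : ℂ) *
          R (rPlus M a + (rPlus M a - rMinus M a) * y)) (W' x) x ∧
        HasDerivAt W' (W'' x) x ∧
        W'' x =
          ((((Λ - 2 * a * m * ω) * (x * (x + 1)) -
                  (radialK a ω m (rPlus M a + (rPlus M a - rMinus M a) * x) /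
                      (rPlus M a - rMinus M a)) ^ 2 - 1 / 4) /
                (x * (x + 1)) ^ 2 : ℝ) : ℂ) *
            (((Real.sqrt (x * (x + 1)) : ℝ) : ℂ) *
              R (rPlus M a + (rPlus M a - rMinus M a) * x)))
    {x : ℝ} (hx : x ∈ Ioc (0 : ℝ) 1) :
    ‖((Real.sqrt (x * (x + 1)) : ℝ) : ℂ) *
          R (rPlus M a + (rPlus M a - rMinus M a) * x)‖ ^ 2 ≤
        x * (Real.exp ((1 + (4 * Λ + 6 * M * |ω| * (2 + 6 * M * |ω|) + 15 / 4)) ^ 2) /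
          (rPlus M a ^ 2 + a ^ 2)) ∧
      ‖(x : ℂ) * W' x - ((1 / 2 : ℂ) + horizonExponent M a ω m) *
          (((Real.sqrt (x * (x + 1)) : ℝ) : ℂ) *
            R (rPlus M a + (rPlus M a - rMinus M a) * x))‖ ^ 2 ≤
        x ^ 2 * (Real.exp ((1 + (4 * Λ + 6 * M * |ω| * (2 + 6 * M * |ω|) + 15 / 4)) ^ 2) /
          (rPlus M a ^ 2 + a ^ 2)) := by
  have h := blowup_pocketEnergy_le hM ha hadm hξ hn hW hx
  have hA : 0 < rPlus M a ^ 2 + a ^ 2 := by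
    have := rPlus_pos hM a; positivity
  set C := 4 * Λ + 6 * M * |ω| * (2 + 6 * M * |ω|) + 15 / 4 with hC
  have hexp : Real.exp ((1 + C) ^ 2 * x) ≤ Real.exp ((1 + C) ^ 2) :=
    Real.exp_le_exp.2 (by nlinarith [sq_nonneg (1 + C), hx.1, hx.2])
  have h' := h.trans (mul_le_mul_of_nonneg_left hexp (inv_pos.2 hA).le)
  rw [inv_mul_eq_div] at h'
  exact norm_sq_le_of_regularSingularEnergy_le hx.1 h'

end Kerr

end Literature.Geometry.Lorentzian

end
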